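import Literature.Probability.LatticeModels.SpinWaveComplexStabilityTorus
import HarnessLib

/-!
# The pinned spin-wave field on `(ℤ/Lℤ)^d` and its complex stability under admissible two-current tilts

Topic `Probability/LatticeModels`; sequel to `SpinWaveComplexStabilityTorus.lean`, which proves
spin-wave (Gaussian) complex stability on the torus for an ABSTRACT injective gradient matrix `D`.
Here we supply the concrete one: the **pinned discrete gradient** `pinnedGradient o` of the torus
`(ℤ/Lℤ)^d` — rows the directed bonds `b = (x, i)`, columns the sites `≠ o`,
`(Dφ)_{(x,i)} = φ̃(x + eᵢ) − φ̃(x)` with `φ̃(o) = 0` — and prove it is injective (pinning one site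
kills the constant zero mode of the massless field; the torus graph is connected). Consequently
(`integral_cexp_pinnedSpinWave_torus_ne_zero`): for every `L ≥ 1`, every pin `o`, every
`J > 288 ε` and every complex two-current kernel with `‖K(b,b')‖ ≤ ε (1 + dist(x,x'))⁻⁴`,

  `∫ exp(−(J/2) Σ_{(x,i)} (φ̃(x+eᵢ) − φ̃(x))² + Σ_{b,b'} K(b,b') (∇φ̃)_b (∇φ̃)_{b'}) dφ ≠ 0`,

the integral running over `φ : {y ≠ o} → ℝ`. This is, verbatim up to the caricature
`cos ↦ 1 − η²/2`, `sin ↦ η`, `[0,2π]^Λ ↦ ℝ^{Λ∖o}`, the zero-freeness half of the open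
"complex stability" stub of crux
`Summit.HubbardSuperconductivity.HubbardSuperconductivity.Theses.NodalWardXY.PerturbedXYOrder`
(`Cruxes/PerturbedXYOrder/Lines/schwarz_inheritance.lean`, `stub_complexStability`), with an
`L`-independent radius `ε < J/288`: the Gaussian level of that crux is a theorem; what remains
open is the non-Gaussian remainder uniformly in `L`.

## Contents
* `pinExt`, `pinnedGradient`, `pinnedGradient_mulVec` — the pinned gradient and its action;
* `eq_zero_of_pinnedGradient_mulVec_eq_zero`, `pinnedGradient_injective` — no zero mode;
* `integral_cexp_pinnedSpinWave_torus_ne_zero` — the zero-freeness statement on `(ℤ/Lℤ)³`.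
-/

noncomputable section

namespace Literature.Probability.LatticeModels

open MeasureTheory Matrix Complex Finset
open scoped BigOperators

section Pinned

variable {d L : ℕ}

/-- Extension by zero at the pin: `pinExt o φ z = φ z` for `z ≠ o` and `= 0` at `z = o` (the field
`φ̃` on all of `(ℤ/Lℤ)^d`). [folklore] -/
def pinExt (o : TorusSite d L) (φ : {y : TorusSite d L // y ≠ o} → ℝ) (z : TorusSite d L) : ℝ :=
  if h : z = o then 0 else φ ⟨z, h⟩

/-- **The pinned discrete gradient** of the torus `(ℤ/Lℤ)^d`: rows are the directed bonds
`b = (x, i)` (from `x` to `x + eᵢ`), columns the sites other than the pin `o`, entries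
`[y = x + eᵢ] − [y = x]`, so that `(Dφ)_{(x,i)} = φ̃(x + eᵢ) − φ̃(x)` (`pinnedGradient_mulVec`).
`J · DᵀD` is the Dirichlet (spin-wave stiffness) form of the torus restricted to fields vanishing
at `o`. [folklore] -/
def pinnedGradient (o : TorusSite d L) :
    Matrix (TorusSite d L × Fin d) {y : TorusSite d L // y ≠ o} ℝ :=
  Matrix.of fun b y =>
    (if (y : TorusSite d L) = b.1 + Pi.single b.2 1 then (1 : ℝ) else 0) -
      (if (y : TorusSite d L) = b.1 then (1 : ℝ) else 0)

variable [NeZero L]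

/-- Evaluation of an indicator sum over the punctured site set:
`Σ_{y ≠ o} [y = z] φ(y) = φ̃(z)`. [folklore] -/
theorem sum_ite_coe_eq_mul (o : TorusSite d L) (φ : {y : TorusSite d L // y ≠ o} → ℝ) (z : TorusSite d L) :
    ∑ y : {y : TorusSite d L // y ≠ o}, (if (y : TorusSite d L) = z then (1 : ℝ) else 0) * φ y =
      pinExt o φ z := by
  by_cases hz : z = o
  · subst hz
    rw [pinExt, dif_pos rfl]
    refine Finset.sum_eq_zero fun y _ => ?_
    rw [if_neg y.2, zero_mul]
  · rw [pinExt, dif_neg hz, Finset.sum_eq_single (⟨z, hz⟩ : {y : TorusSite d L // y ≠ o})]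
    · simp
    · intro y _ hy
      rw [if_neg, zero_mul]
      intro h
      exact hy (Subtype.ext h)
    · intro h; exact absurd (Finset.mem_univ _) h

/-- `(Dφ)_{(x,i)} = φ̃(x + eᵢ) − φ̃(x)`. [folklore] -/
theorem pinnedGradient_mulVec (o : TorusSite d L) (φ : {y : TorusSite d L // y ≠ o} → ℝ)
    (b : TorusSite d L × Fin d) :
    (pinnedGradient o *ᵥ φ) b = pinExt o φ (b.1 + Pi.single b.2 1) - pinExt o φ b.1 := by
  simp only [pinnedGradient, Matrix.mulVec, dotProduct, Matrix.of_apply, sub_mul, Finset.sum_sub_distrib,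
    sum_ite_coe_eq_mul]

/-- A field with vanishing pinned gradient vanishes: `Dφ = 0 → φ = 0` (the torus graph is connected,
`torusGraph_reachable`, and `φ̃(o) = 0`). [folklore] -/
theorem eq_zero_of_pinnedGradient_mulVec_eq_zero (o : TorusSite d L) {φ : {y : TorusSite d L // y ≠ o} → ℝ}
    (h : pinnedGradient o *ᵥ φ = 0) : φ = 0 := by
  have hstep : ∀ (x : TorusSite d L) (i : Fin d), pinExt o φ (x + Pi.single i 1) = pinExt o φ x := by
    intro x i
    have := congrFun h (x, i)
    rw [pinnedGradient_mulVec] at this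
    simpa [sub_eq_zero] using this
  have hadj : ∀ {u v : TorusSite d L}, (torusGraph d L).Adj u v → pinExt o φ u = pinExt o φ v := by
    intro u v huv
    rcases (torusGraph_adj_iff u v).mp huv with ⟨-, ⟨i, hi⟩ | ⟨i, hi⟩⟩
    · rw [hi, hstep]
    · rw [hi, hstep]
  have hwalk : ∀ {u v : TorusSite d L} (p : (torusGraph d L).Walk u v), pinExt o φ u = pinExt o φ v := by
    intro u v p
    induction p with
    | nil => rfl
    | cons hst _ ih => exact (hadj hst).trans ih
  have hconst : ∀ x : TorusSite d L, pinExt o φ x = pinExt o φ o := fun x =>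
    (torusGraph_reachable x o).elim fun p => hwalk p
  funext y
  have hy := hconst y
  rw [pinExt, dif_neg y.2, pinExt, dif_pos rfl] at hy
  exact hy

/-- **The pinned gradient is injective** (no zero mode after pinning). [folklore] -/
theorem pinnedGradient_injective (o : TorusSite d L) : Function.Injective (pinnedGradient o).mulVec := by
  intro φ₁ φ₂ h
  have h0 : pinnedGradient o *ᵥ (φ₁ - φ₂) = 0 := by rw [Matrix.mulVec_sub, h, sub_self]
  exact sub_eq_zero.mp (eq_zero_of_pinnedGradient_mulVec_eq_zero o h0)

end Pinned

/-- **Complex stability of the pinned spin-wave torus field under admissible two-current tilts,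
uniformly in `L`.** For every side `L ≥ 1`, pin `o`, stiffness `J > 288 ε` and complex kernel with
`‖K(b,b')‖ ≤ ε (1 + dist(x,x'))⁻⁴` on the directed bonds of `(ℤ/Lℤ)³`:
`∫_{φ : {y ≠ o} → ℝ} exp(−(J/2) Σ_b (∇φ̃)_b² + Σ_{b,b'} K(b,b') (∇φ̃)_b (∇φ̃)_{b'}) dφ ≠ 0`,
`(∇φ̃)_{(x,i)} = φ̃(x+eᵢ) − φ̃(x)`. (The Gaussian / spin-wave level of the zero-freeness half of
`stub_complexStability` of crux `…Theses.NodalWardXY.PerturbedXYOrder`, radius independent of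
`L`.) [folklore] -/
theorem integral_cexp_pinnedSpinWave_torus_ne_zero {L : ℕ} [NeZero L] (o : TorusSite 3 L) {J ε : ℝ}
    (hJ : 288 * ε < J) (K : (TorusSite 3 L × Fin 3) → (TorusSite 3 L × Fin 3) → ℂ)
    (hK : ∀ b b', ‖K b b'‖ ≤ ε / (1 + ((torusGraph 3 L).dist b.1 b'.1 : ℝ)) ^ 4) :
    (∫ φ : {y : TorusSite 3 L // y ≠ o} → ℝ,
        cexp (-((J / 2 : ℝ) : ℂ) * ((∑ b, (pinnedGradient o *ᵥ φ) b ^ 2 : ℝ) : ℂ) +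
          ∑ b, ∑ b', K b b' * ((pinnedGradient o *ᵥ φ) b : ℂ) * ((pinnedGradient o *ᵥ φ) b' : ℂ))) ≠ 0 :=
  integral_cexp_spinWave_torus_ne_zero (pinnedGradient o) (pinnedGradient_injective o) hJ K hK

end Literature.Probability.LatticeModels

end
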